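import Summits.NavierStokesRegularity.NavierStokesRegularity.Theorems.CoriolisHeadTypeIRateHessianRate
import Summits.NavierStokesRegularity.NavierStokesRegularity.Theorems.CoriolisHeadTypeIRateOfLaplacianGradientDecay
import HarnessLib

/-!
# CoriolisHeadTypeIRateOfThirdOrderDecay — crux `NoCoRotatingCore` (stmt-NavierStokesRegularity-22676), line
# `far_field_constancy` v2 (skeleton 15c9a82ad206abb9), stub K1c `stub_typeIRate`:
# **K1c HOLDS UNDER SCALE-NATURAL DECAY TO THIRD ORDER** (pressure-Hessian rate 4/4, the closing file)

`TypeIRate.typeIRate_of_third_order_decay`: let `(U, P)` be a bounded smooth rotated Leray profile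
(`−νΔU + aU + a(y·∇)U + (BU − (By·∇)U) + (U·∇)U + ∇P = 0`, `div U = 0`, `ν, a > 0`, `B` skew) satisfying the line's
K1a (`‖y‖‖DU‖ + ‖y‖²‖D²U‖ → 0`) and K1b's conclusion `U → b`.  IF moreover `‖D(ΔU)(y)‖ ≤ C₃/‖y‖²` beyond some
radius — the THIRD-ORDER companion of K1a (`r³‖D³U‖ → 0` implies it) — THEN `‖U(y) − b‖ ≤ K/(1 + ‖y‖)`, i.e. the
conclusion of K1c.  Everything else in the chain is kernel-checked in the tree (all `--supports 22676 --as helper`):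
`‖∇ΔP‖ ≤ 6‖DU‖‖D²U‖` (`norm_fderiv_laplacian_pressure_le`, here) and `|ΔP| ≤ 3‖DU‖²` give, with K1a and compactness,
`|ΔP| ≤ K₂(1+r)^{−2}`, `‖∇ΔP‖ ≤ K₃(1+r)^{−3}`; the centred dyadic telescoping with one/two integrations by parts
(`…HessianKernel`, `…HessianWeight`, `…HessianRate`) gives the PRESSURE-HESSIAN RATE `‖D(∇P)‖ ≤ C_H/r²`; the
differentiated system with damping `2a` and the matrix transport lemma (`…GradientTransport`) give the power gain
`‖DU‖ ≤ C₁/r^{3/2}`; the pressure-gradient rate (`…PressureKernel/Rate`) and the transport half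
(`…TypeIRateReduction`, `…OfGradientDecay`, `…OfLaplacianGradientDecay`) give the Type-I rate.

HONEST FRAMING / FOR THE PLANNER (ns-idea-10).  K1c AS REGISTERED (hypothesis K1a only, to second order) stays OPEN;
this file shows that its remaining content is EXACTLY one more order of scale-natural decay.  Recommended restatement
of the line: ONE analytic crux K1a₃ («`r^k‖D^kU‖ → 0` for `k = 1, 2, 3`», same nature as K1a — any blow-down /
compactness proof of K1a yields all orders) + the printed residual `stub_pineauVicolConjecture`; K1b (landed by
seat ns-s29-p2) and K1c then follow by the landed files.  Nothing here proves K1a, `NoCoRotatingCore`, Pineau–Vicol's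
Conjecture 1.1 or Navier–Stokes regularity.

References: line card `Cruxes/NoCoRotatingCore/Lines/far_field_constancy.md` (K1c block); B. Pineau, V. Vicol,
arXiv:2607.09619 (2026), (1.8), Conj. 1.1, Prop. 3.1 [PineauVicol2026]; D. Gilbarg, N. S. Trudinger (2001) §4.2
[GilbargTrudinger2001].
-/

noncomputable section

open MeasureTheory Set Function Filter Topology Metric InnerProductSpace Real
open scoped RealInnerProductSpace Laplacian ContDiff

-- the summit and its single sub-problem share the name (CONVENTIONS §1), as in every Theorems file
set_option linter.dupNamespace false
-- nested operator types
set_option maxSynthPendingDepth 3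

namespace Summit.NavierStokesRegularity.NavierStokesRegularity.Theorems.CoriolisHead

namespace TypeIRate

open Literature.Analysis.FluidPDE

section Profile

variable {ν a : ℝ} {B : EuclideanSpace ℝ (Fin 3) →L[ℝ] EuclideanSpace ℝ (Fin 3)}
  {U : EuclideanSpace ℝ (Fin 3) → EuclideanSpace ℝ (Fin 3)} {P : EuclideanSpace ℝ (Fin 3) → ℝ}

/-- **`‖∇ΔP(w)‖ ≤ 6‖DU(w)‖‖D²U(w)‖`** for a rotated profile: `ΔP = −tr(DU∘DU)`, so
`∂ᵥΔP = −tr(D²U(v)∘DU + DU∘D²U(v))` and `|tr L| ≤ 3‖L‖` on `ℝ³`. [cite: PineauVicol2026, proof of Lemma 2.1 (p. 9)] -/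
theorem norm_fderiv_laplacian_pressure_le (hU : ContDiff ℝ (⊤ : ℕ∞) U) (hP2 : ContDiff ℝ 2 P)
    (hdiv : VectorCalculus.IsDivFree U)
    (heq : ∀ y, -(ν • (Δ U) y) + a • U y + a • fderiv ℝ U y y + (B (U y) - fderiv ℝ U y (B y)) +
      convect U U y + gradient P y = 0) (w : EuclideanSpace ℝ (Fin 3)) :
    ‖fderiv ℝ (Δ P) w‖ ≤ 6 * ‖fderiv ℝ U w‖ * ‖iteratedFDeriv ℝ 2 U w‖ := by
  have hU3 : ContDiff ℝ 3 U := hU.of_le (by norm_cast)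
  have hU2 : ContDiff ℝ 2 U := hU.of_le (by norm_cast)
  have hDUd : Differentiable ℝ (fderiv ℝ U) :=
    (hU2.fderiv_right (m := 1) (by norm_cast)).differentiable one_ne_zero
  -- `ΔP` as a function
  have hf : (Δ P) = fun z => -traceCLM ((fderiv ℝ U z).comp (fderiv ℝ U z)) :=
    funext fun z => laplacian_pressure_eq_of_rotated hU3 hP2 hdiv heq z
  -- derivative of `z ↦ (DU z).comp (DU z)`
  have hc : HasFDerivAt (fun z => (fderiv ℝ U z).comp (fderiv ℝ U z))
      ((ContinuousLinearMap.compL ℝ (EuclideanSpace ℝ (Fin 3)) (EuclideanSpace ℝ (Fin 3)) (EuclideanSpace ℝ (Fin 3))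
          (fderiv ℝ U w)).comp (fderiv ℝ (fderiv ℝ U) w) +
        ((ContinuousLinearMap.compL ℝ (EuclideanSpace ℝ (Fin 3)) (EuclideanSpace ℝ (Fin 3)) (EuclideanSpace ℝ (Fin 3))).flip
          (fderiv ℝ U w)).comp (fderiv ℝ (fderiv ℝ U) w)) w :=
    (hDUd w).hasFDerivAt.clm_comp (hDUd w).hasFDerivAt
  have hd : HasFDerivAt (Δ P) (-(traceCLM.comp
      ((ContinuousLinearMap.compL ℝ (EuclideanSpace ℝ (Fin 3)) (EuclideanSpace ℝ (Fin 3)) (EuclideanSpace ℝ (Fin 3))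
          (fderiv ℝ U w)).comp (fderiv ℝ (fderiv ℝ U) w) +
        ((ContinuousLinearMap.compL ℝ (EuclideanSpace ℝ (Fin 3)) (EuclideanSpace ℝ (Fin 3)) (EuclideanSpace ℝ (Fin 3))).flip
          (fderiv ℝ U w)).comp (fderiv ℝ (fderiv ℝ U) w)))) w := by
    rw [hf]
    exact (traceCLM.hasFDerivAt.comp w hc).neg
  rw [hd.fderiv]
  have hnorm2 : ‖fderiv ℝ (fderiv ℝ U) w‖ = ‖iteratedFDeriv ℝ 2 U w‖ := by
    rw [← norm_iteratedFDeriv_zero (𝕜 := ℝ) (f := fderiv ℝ (fderiv ℝ U)), norm_iteratedFDeriv_fderiv,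
      norm_iteratedFDeriv_fderiv]
  refine ContinuousLinearMap.opNorm_le_bound _ (by positivity) fun v => ?_
  simp only [_root_.neg_apply, norm_neg, ContinuousLinearMap.comp_apply, _root_.add_apply,
    ContinuousLinearMap.compL_apply, ContinuousLinearMap.flip_apply]
  have h1 := abs_traceCLM_le_three_mul_opNorm
    ((fderiv ℝ U w).comp (fderiv ℝ (fderiv ℝ U) w v) + (fderiv ℝ (fderiv ℝ U) w v).comp (fderiv ℝ U w))
  rw [← Real.norm_eq_abs] at h1
  refine h1.trans ?_
  have h2 : ‖(fderiv ℝ U w).comp (fderiv ℝ (fderiv ℝ U) w v) + (fderiv ℝ (fderiv ℝ U) w v).comp (fderiv ℝ U w)‖ ≤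
      2 * (‖fderiv ℝ U w‖ * (‖fderiv ℝ (fderiv ℝ U) w‖ * ‖v‖)) := by
    have hv : ‖fderiv ℝ (fderiv ℝ U) w v‖ ≤ ‖fderiv ℝ (fderiv ℝ U) w‖ * ‖v‖ := ContinuousLinearMap.le_opNorm _ _
    calc ‖(fderiv ℝ U w).comp (fderiv ℝ (fderiv ℝ U) w v) + (fderiv ℝ (fderiv ℝ U) w v).comp (fderiv ℝ U w)‖
        ≤ ‖(fderiv ℝ U w).comp (fderiv ℝ (fderiv ℝ U) w v)‖ + ‖(fderiv ℝ (fderiv ℝ U) w v).comp (fderiv ℝ U w)‖ :=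
          norm_add_le _ _
      _ ≤ ‖fderiv ℝ U w‖ * ‖fderiv ℝ (fderiv ℝ U) w v‖ + ‖fderiv ℝ (fderiv ℝ U) w v‖ * ‖fderiv ℝ U w‖ :=
          add_le_add (ContinuousLinearMap.opNorm_comp_le _ _) (ContinuousLinearMap.opNorm_comp_le _ _)
      _ ≤ 2 * (‖fderiv ℝ U w‖ * (‖fderiv ℝ (fderiv ℝ U) w‖ * ‖v‖)) := by
          nlinarith [mul_le_mul_of_nonneg_left hv (norm_nonneg (fderiv ℝ U w)), norm_nonneg (fderiv ℝ U w)]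
  rw [hnorm2] at h2
  nlinarith [h2, norm_nonneg v, norm_nonneg (fderiv ℝ U w), norm_nonneg (iteratedFDeriv ℝ 2 U w)]

/-- **K1c from scale-natural decay to THIRD order (stub `stub_typeIRate` modulo K1a₃).**  For a bounded smooth
rotated Leray profile with the line's K1a and K1b's conclusion `U → b`, IF beyond some radius the gradient of the
Laplacian decays like `‖D(ΔU)(y)‖ ≤ C₃/‖y‖²` (implied by `r³‖D³U‖ → 0`, the third-order companion of K1a), THEN the
Type-I rate `‖U(y) − b‖ ≤ K/(1 + ‖y‖)` holds.  Chain (all landed): K1a + compactness give `|ΔP| ≤ K₂(1+r)^{−2}` and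
`‖∇ΔP‖ ≤ 6‖DU‖‖D²U‖ ≤ K₃(1+r)^{−3}`; `∇P → g` (`CoriolisHeadFarFieldGradientLimit`); the pressure-Hessian rate
`‖D(∇P)‖ ≤ C_H/r²` (`norm_fderiv_gradient_le`); and `typeIRate_of_laplacian_gradient_and_hessian_decay` (derivative
transport with damping `2a`, power gain for `DU`, pressure rate by telescoping, transport half).  HONEST FRAMING:
K1c AS REGISTERED (hypothesis K1a only) stays OPEN — what this shows is that its content is EXACTLY one more order
of scale-natural decay; nothing here proves `NoCoRotatingCore`, Pineau–Vicol's conjecture or NS regularity.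
[cite: PineauVicol2026, Conj. 1.1, Prop. 3.1] -/
theorem typeIRate_of_third_order_decay (hν : 0 < ν) (ha : 0 < a)
    (hB : ∀ x, inner ℝ (B x) x = 0) (hU : ContDiff ℝ (⊤ : ℕ∞) U) (hP : ContDiff ℝ 2 P)
    (hdiv : VectorCalculus.IsDivFree U)
    (heq : ∀ y, -(ν • (Δ U) y) + a • U y + a • fderiv ℝ U y y + (B (U y) - fderiv ℝ U y (B y)) +
      convect U U y + gradient P y = 0)
    (hbdd : ∃ M : ℝ, ∀ y, ‖U y‖ ≤ M)
    (hdecay : ∀ ε : ℝ, 0 < ε → ∃ R : ℝ, ∀ y : EuclideanSpace ℝ (Fin 3), R ≤ ‖y‖ →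
      ‖y‖ * ‖fderiv ℝ U y‖ + ‖y‖ ^ 2 * ‖iteratedFDeriv ℝ 2 U y‖ ≤ ε)
    (b : EuclideanSpace ℝ (Fin 3))
    (hlim : ∀ ε : ℝ, 0 < ε → ∃ R : ℝ, ∀ y : EuclideanSpace ℝ (Fin 3), R ≤ ‖y‖ → ‖U y - b‖ ≤ ε)
    (hΔ3 : ∃ C₃ R₃ : ℝ, ∀ y : EuclideanSpace ℝ (Fin 3), R₃ ≤ ‖y‖ → ‖fderiv ℝ (Δ U) y‖ ≤ C₃ / ‖y‖ ^ 2) :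
    ∃ K : ℝ, ∀ y : EuclideanSpace ℝ (Fin 3), ‖U y - b‖ ≤ K / (1 + ‖y‖) := by
  have hU3 : ContDiff ℝ 3 U := hU.of_le (by norm_cast)
  have hU2 : ContDiff ℝ 2 U := hU.of_le (by norm_cast)
  have hP1 : ContDiff ℝ 1 P := hP.of_le one_le_two
  have hPinf : ContDiff ℝ ∞ P := contDiff_pressure_of_rotated hU hP1 heq
  -- `∇P → g`
  obtain ⟨g, hg⟩ := FarFieldLimit.exists_gradient_pressure_limit hν ha hB hU hP hdiv heq hbdd hdecay
  -- K1a at level `1` and bounds on the ball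
  obtain ⟨R₁, hR₁1, hR₁⟩ := FarFieldLimit.exists_radius_decay hdecay one_pos
  obtain ⟨D₀, hD₀⟩ := (isCompact_closedBall (0 : EuclideanSpace ℝ (Fin 3)) R₁).exists_bound_of_continuousOn
    ((hU.continuous_fderiv (by simp)).continuousOn)
  obtain ⟨D₂, hD₂⟩ := (isCompact_closedBall (0 : EuclideanSpace ℝ (Fin 3)) R₁).exists_bound_of_continuousOn
    ((hU2.continuous_iteratedFDeriv (m := 2) le_rfl).continuousOn)
  have hD₀0 : 0 ≤ D₀ := (norm_nonneg _).trans (hD₀ 0 (mem_closedBall_self (by linarith)))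
  have hD₂0 : 0 ≤ D₂ := (norm_nonneg _).trans (hD₂ 0 (mem_closedBall_self (by linarith)))
  -- global bounds `|ΔP| ≤ K₂ (1+r)^{-2}`, `‖∇ΔP‖ ≤ K₃ (1+r)^{-3}`
  set K₂ : ℝ := 12 + 3 * D₀ ^ 2 * (1 + R₁) ^ 2 with hK₂
  set K₃ : ℝ := 48 + 6 * D₀ * D₂ * (1 + R₁) ^ 3 with hK₃
  have hK₂0 : 0 ≤ K₂ := by positivity
  have hK₃0 : 0 ≤ K₃ := by positivity
  have hΔ : ∀ w : EuclideanSpace ℝ (Fin 3), |(Δ P) w| ≤ K₂ / (1 + ‖w‖) ^ (2 : ℝ) := by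
    intro w
    rw [Real.rpow_two]
    have hsq := abs_laplacian_pressure_le_sq hU3 hP hdiv heq w
    have h1w : 0 < (1 + ‖w‖) ^ 2 := by positivity
    rw [le_div_iff₀ h1w]
    by_cases hw : R₁ ≤ ‖w‖
    · have hw1 : 1 ≤ ‖w‖ := hR₁1.trans hw
      have hwpos : 0 < ‖w‖ := by linarith
      have hDw : ‖fderiv ℝ U w‖ ≤ 1 / ‖w‖ := (hR₁ w hw).1
      have hDw' : ‖fderiv ℝ U w‖ * ‖w‖ ≤ 1 := by rwa [le_div_iff₀ hwpos] at hDw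
      have hsq2 : ‖fderiv ℝ U w‖ ^ 2 * ‖w‖ ^ 2 ≤ 1 := by
        have h0 : 0 ≤ ‖fderiv ℝ U w‖ * ‖w‖ := by positivity
        nlinarith
      have h12 : (1 + ‖w‖) ^ 2 ≤ 4 * ‖w‖ ^ 2 := by nlinarith
      calc |(Δ P) w| * (1 + ‖w‖) ^ 2 ≤ 3 * ‖fderiv ℝ U w‖ ^ 2 * (4 * ‖w‖ ^ 2) :=
            mul_le_mul hsq h12 (by positivity) (by positivity)
        _ = 12 * (‖fderiv ℝ U w‖ ^ 2 * ‖w‖ ^ 2) := by ring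
        _ ≤ 12 * 1 := by nlinarith
        _ ≤ K₂ := by rw [hK₂]; nlinarith [sq_nonneg D₀, sq_nonneg (1 + R₁)]
    · rw [not_le] at hw
      have hDw : ‖fderiv ℝ U w‖ ≤ D₀ := hD₀ w (mem_closedBall_zero_iff.2 hw.le)
      have hsq2 : ‖fderiv ℝ U w‖ ^ 2 ≤ D₀ ^ 2 := pow_le_pow_left₀ (norm_nonneg _) hDw 2
      have h12 : (1 + ‖w‖) ^ 2 ≤ (1 + R₁) ^ 2 := pow_le_pow_left₀ (by positivity) (by linarith) 2
      calc |(Δ P) w| * (1 + ‖w‖) ^ 2 ≤ 3 * ‖fderiv ℝ U w‖ ^ 2 * (1 + R₁) ^ 2 :=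
            mul_le_mul hsq h12 (by positivity) (by positivity)
        _ ≤ 3 * D₀ ^ 2 * (1 + R₁) ^ 2 := by nlinarith [sq_nonneg (1 + R₁)]
        _ ≤ K₂ := by rw [hK₂]; linarith
  have hΔ' : ∀ w : EuclideanSpace ℝ (Fin 3), ‖fderiv ℝ (Δ P) w‖ ≤ K₃ / (1 + ‖w‖) ^ (3 : ℝ) := by
    intro w
    rw [show (1 + ‖w‖) ^ (3 : ℝ) = (1 + ‖w‖) ^ 3 from Real.rpow_ofNat (1 + ‖w‖) 3]
    have hgr := norm_fderiv_laplacian_pressure_le hU hP hdiv heq w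
    have h1w : 0 < (1 + ‖w‖) ^ 3 := by positivity
    rw [le_div_iff₀ h1w]
    by_cases hw : R₁ ≤ ‖w‖
    · have hw1 : 1 ≤ ‖w‖ := hR₁1.trans hw
      have hwpos : 0 < ‖w‖ := by linarith
      obtain ⟨hDw, hD2w⟩ := hR₁ w hw
      have hDw' : ‖fderiv ℝ U w‖ * ‖w‖ ≤ 1 := by rwa [le_div_iff₀ hwpos] at hDw
      have hD2w' : ‖iteratedFDeriv ℝ 2 U w‖ * ‖w‖ ^ 2 ≤ 1 := by rwa [le_div_iff₀ (pow_pos hwpos 2)] at hD2w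
      have hprod : ‖fderiv ℝ U w‖ * ‖iteratedFDeriv ℝ 2 U w‖ * ‖w‖ ^ 3 ≤ 1 := by
        have h := mul_le_mul hDw' hD2w' (by positivity) zero_le_one
        calc ‖fderiv ℝ U w‖ * ‖iteratedFDeriv ℝ 2 U w‖ * ‖w‖ ^ 3 =
            (‖fderiv ℝ U w‖ * ‖w‖) * (‖iteratedFDeriv ℝ 2 U w‖ * ‖w‖ ^ 2) := by ring
          _ ≤ 1 * 1 := h
          _ = 1 := one_mul _
      have h12 : (1 + ‖w‖) ^ 3 ≤ 8 * ‖w‖ ^ 3 := by nlinarith [pow_le_pow_left₀ (by positivity : (0:ℝ) ≤ 1 + ‖w‖) (by linarith : 1 + ‖w‖ ≤ 2 * ‖w‖) 3]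
      calc ‖fderiv ℝ (Δ P) w‖ * (1 + ‖w‖) ^ 3 ≤ (6 * ‖fderiv ℝ U w‖ * ‖iteratedFDeriv ℝ 2 U w‖) * (8 * ‖w‖ ^ 3) :=
            mul_le_mul hgr h12 (by positivity) (by positivity)
        _ = 48 * (‖fderiv ℝ U w‖ * ‖iteratedFDeriv ℝ 2 U w‖ * ‖w‖ ^ 3) := by ring
        _ ≤ 48 * 1 := by nlinarith
        _ ≤ K₃ := by rw [hK₃]; nlinarith [mul_nonneg (mul_nonneg hD₀0 hD₂0) (pow_nonneg (by positivity : (0:ℝ) ≤ 1 + R₁) 3)]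
    · rw [not_le] at hw
      have hDw : ‖fderiv ℝ U w‖ ≤ D₀ := hD₀ w (mem_closedBall_zero_iff.2 hw.le)
      have hD2w : ‖iteratedFDeriv ℝ 2 U w‖ ≤ D₂ := hD₂ w (mem_closedBall_zero_iff.2 hw.le)
      have h12 : (1 + ‖w‖) ^ 3 ≤ (1 + R₁) ^ 3 := pow_le_pow_left₀ (by positivity) (by linarith) 3
      have hprod : ‖fderiv ℝ U w‖ * ‖iteratedFDeriv ℝ 2 U w‖ ≤ D₀ * D₂ :=
        mul_le_mul hDw hD2w (norm_nonneg _) hD₀0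
      calc ‖fderiv ℝ (Δ P) w‖ * (1 + ‖w‖) ^ 3 ≤ (6 * ‖fderiv ℝ U w‖ * ‖iteratedFDeriv ℝ 2 U w‖) * (1 + R₁) ^ 3 :=
            mul_le_mul hgr h12 (by positivity) (by positivity)
        _ ≤ 6 * (D₀ * D₂) * (1 + R₁) ^ 3 := by
            have := pow_nonneg (by positivity : (0:ℝ) ≤ 1 + R₁) 3
            nlinarith
        _ ≤ K₃ := by rw [hK₃]; linarith
  -- the kernel constants and the Hessian rate
  obtain ⟨CΓ, hCΓ0, hCΓ⟩ := exists_sq_mul_norm_fderiv_newtonFar_le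
  obtain ⟨-, -, ⟨M₂, hM₂⟩, -, -⟩ := exists_bound_newtonFar_derivs one_pos (one_lt_two : (1 : ℝ) < 2)
  obtain ⟨Ml, -, hMl⟩ := exists_bound_fderiv_newtonFarLaplacian one_pos (one_lt_two : (1 : ℝ) < 2)
  have hHess : ∃ CH RH : ℝ, ∀ y : EuclideanSpace ℝ (Fin 3), RH ≤ ‖y‖ → ‖fderiv ℝ (gradient P) y‖ ≤ CH / ‖y‖ ^ 2 :=
    ⟨(128 * CΓ * K₃ + 15360 * M₂ * K₂) * (volume (ball (0 : EuclideanSpace ℝ (Fin 3)) 1)).toReal, 1,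
      fun y hy => norm_fderiv_gradient_le hCΓ0 hCΓ hM₂ hMl hPinf hK₂0 hK₃0 hΔ hΔ' hg y hy⟩
  exact typeIRate_of_laplacian_gradient_and_hessian_decay hν ha hB hU hP hdiv heq hbdd hdecay b hlim hΔ3 hHess

end Profile

end TypeIRate

end Summit.NavierStokesRegularity.NavierStokesRegularity.Theorems.CoriolisHead

end
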